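import Mathlib.Data.Real.Basic
import Mathlib.Tactic.Ring
import Mathlib.Tactic.Linarith
import Mathlib.Tactic.LinearCombination
import HarnessLib

/-!
# Conjecture N (hodge-weil ladder, GAPS G51b), format (5,3): the all-`y` divided-difference identities for the F-pair (2,3)

Prover 2, generation 21, completing generation 20's `WeilClassTestFormatFiveThreeTimeIdentity` (which carries the pair (1,2) and its pure form; the
five-theorem file of generation 20 exceeded the elaboration budget, so the remaining identities land in separate files — referee R696 (b) / N-P2g20-ops-1).
Setting and notation as there: time picture `U_e(y) = u_e + y·A_e`, `w_g(y) = v_g + y·B_g`, virtual alphabet `L(y) = {U_e(y)} ⊖ {w_g(y)}` with power sums `p_n(y)`,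
`e₃ = p₃/3`, `e₄ = (p₂² − 2p₄)/8` (valid because `p₁ ≡ 0` by centring), `Π_g(y) = ∏_e (U_e(y) − w_g(y))`. THE IDENTITIES (centring only, all `y`):
`Π_g(y) − Π_h(y) = (w_h − w_g)(y)·(e₄(y) + e₃(y)·w_k(y))` for `{g,h,k} = {2,3,1}` (the pair (1,3) lands in the sibling file `…TimeIdentityPair13`) — the all-orders form of pv2-g15's `dd0/dd1/dd2_12_sub_13`
companions (changing the node pair changes the divided difference by `e₃`-multiples of the third F-line). Pure algebra (`subst` + `ring`); nothing here is a case of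
HC, a rung or a door edge; no statement of Markman's papers is used. New cell result ⇒ Summits/.
-/

set_option linter.dupNamespace false

namespace Summit.HodgeConjecture.HodgeConjecture.WeilClassTestFormatFiveThreeTimeIdentityPair23

set_option maxRecDepth 100000 in
set_option maxHeartbeats 8000000 in
/-- **Divided-difference identity** for the pair `(F₂, F₃)` (centring only; all `y`): `Π₂(y) − Π₃(y) = (w₃(y) − w₂(y))·(e₄(y) + e₃(y)·w₁(y))`.
[new cell result; pv2-g20] -/
theorem dividedDifference_identity₂₃ (A₁ A₂ A₃ A₄ A₅ B₁ B₂ B₃ u₁ u₂ u₃ u₄ u₅ v₁ v₂ v₃ : ℝ)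
    (hA : A₁ + A₂ + A₃ + A₄ + A₅ = B₁ + B₂ + B₃) (hC : u₁ + u₂ + u₃ + u₄ + u₅ = v₁ + v₂ + v₃) (y : ℝ) :
    (((u₁ - v₂) + y * (A₁ - B₂)) * ((u₂ - v₂) + y * (A₂ - B₂)) * ((u₃ - v₂) + y * (A₃ - B₂)) * ((u₄ - v₂) + y * (A₄ - B₂)) * ((u₅ - v₂) + y * (A₅ - B₂)))
      - (((u₁ - v₃) + y * (A₁ - B₃)) * ((u₂ - v₃) + y * (A₂ - B₃)) * ((u₃ - v₃) + y * (A₃ - B₃)) * ((u₄ - v₃) + y * (A₄ - B₃)) * ((u₅ - v₃) + y * (A₅ - B₃)))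
      = ((v₃ + y * B₃) - (v₂ + y * B₂)) * (((1/8 : ℝ) * ((((u₁ + y * A₁) ^ 2 + (u₂ + y * A₂) ^ 2 + (u₃ + y * A₃) ^ 2 + (u₄ + y * A₄) ^ 2 + (u₅ + y * A₅) ^ 2) - ((v₁ + y * B₁) ^ 2 + (v₂ + y * B₂) ^ 2 + (v₃ + y * B₃) ^ 2)) ^ 2 - 2 * (((u₁ + y * A₁) ^ 4 + (u₂ + y * A₂) ^ 4 + (u₃ + y * A₃) ^ 4 + (u₄ + y * A₄) ^ 4 + (u₅ + y * A₅) ^ 4) - ((v₁ + y * B₁) ^ 4 + (v₂ + y * B₂) ^ 4 + (v₃ + y * B₃) ^ 4)))) + ((1/3 : ℝ) * (((u₁ + y * A₁) ^ 3 + (u₂ + y * A₂) ^ 3 + (u₃ + y * A₃) ^ 3 + (u₄ + y * A₄) ^ 3 + (u₅ + y * A₅) ^ 3) - ((v₁ + y * B₁) ^ 3 + (v₂ + y * B₂) ^ 3 + (v₃ + y * B₃) ^ 3))) * (v₁ + y * B₁)) := by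
  -- eliminate (B₁, v₁), the third line for this pair (see `…TimeIdentityPair13`)
  have hB : B₁ = A₁ + A₂ + A₃ + A₄ + A₅ - B₂ - B₃ := by linarith
  have hv : v₁ = u₁ + u₂ + u₃ + u₄ + u₅ - v₂ - v₃ := by linarith
  subst hB hv
  ring

end Summit.HodgeConjecture.HodgeConjecture.WeilClassTestFormatFiveThreeTimeIdentityPair23
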